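import Summits.CriticalPhenomena.CardyFormulaZ2.Theorems.ParafermionFamiliesToSLESix.Negative.CruxModuloBulkNondegenerate

/-!
# `CardySusyWard.ParafermionFamiliesToSLESix` (stmt-CriticalPhenomena-10814): the conditional closing form
# modulo the named Literature fact `H = ParafermionBulkNondegenerate`, and the shape of the crux as typed

Glue over the landed Negative lemma
`Negative.parafermionFamiliesToSLESix_iff_not_bulkNondegenerate_imp : crux ↔ (¬ H → SLE6LimitZ2AllDiscretisations)`
(cdisprove, `Theorems/ParafermionFamiliesToSLESix/Negative/CruxModuloBulkNondegenerate.lean`), with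
`H = Literature.Probability.LatticeModels.ParafermionBulkNondegenerate` (Duminil-Copin–Smirnov 2012, Conjecture 8.7
non-degeneracy at `q = 1`; Literature-prover verdict open-problem, `[status: open]`):

* `parafermionFamiliesToSLESix_of_bulkNondegenerate : H → crux` — the one-line closing form the crux hinges on
  (skeleton r7 of line `strip-anchored-vertex-normalisation`, lead c6; registered stub name);
* `parafermionFamiliesToSLESix_iff_bulkNondegenerate_or_conjecture : crux ↔ H ∨ SLE6LimitZ2AllDiscretisations` —
  the crux AS TYPED is, classically, the disjunction of the open Literature fact and the sub-problem's own
  conjecture leaf (registered stub name).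

Caveat recorded for the planner (lead c7): the `H`-branch closes the item only VACUOUSLY — by the sibling Negative
lemma `parafermionPrecompact_iff_not_bulkNondegenerate`, `H` refutes the route's own second crux
`ParafermionPrecompact` (stmt-11293) as typed, so the route's deciding theorem `closes` can never be fed along it;
the non-vacuous content of the item is the restated implication with edge-guarded precompactness and an explicit
non-degeneracy hypothesis (Disproof.lean, cycle 2, finding 8).
-/

noncomputable section

namespace Summit.CriticalPhenomena.CardyFormulaZ2.Theorems.ParafermionFamiliesToSLESix.StripAnchored

open Literature.Probability.LatticeModels (ParafermionBulkNondegenerate)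
open Summit.CriticalPhenomena.CardyFormulaZ2.Theses.CardySusyWard (ParafermionFamiliesToSLESix)
open Summit.CriticalPhenomena.CardyFormulaZ2.Theorems.ParafermionFamiliesToSLESix.Negative
  (parafermionFamiliesToSLESix_iff_not_bulkNondegenerate_imp)

/-- **`H` alone closes the crux as typed**: `ParafermionBulkNondegenerate → ParafermionFamiliesToSLESix`.
Under `H` the crux's second hypothesis `ParafermionPrecompact` (as typed, `↔ ¬H`) is contradictory, so the
implication holds vacuously; read through `parafermionFamiliesToSLESix_iff_not_bulkNondegenerate_imp`.
[cite: DuminilCopinSmirnov2012Lattice, Conjecture 8.7] -/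
theorem parafermionFamiliesToSLESix_of_bulkNondegenerate :
    ParafermionBulkNondegenerate → ParafermionFamiliesToSLESix := fun hH =>
  parafermionFamiliesToSLESix_iff_not_bulkNondegenerate_imp.2 fun hn => (hn hH).elim

/-- **The crux as typed is `H ∨ (the sub-problem's conjecture leaf)`** — classical read-back of the landed
`parafermionFamiliesToSLESix_iff_not_bulkNondegenerate_imp` as a disjunction. [folklore] -/
theorem parafermionFamiliesToSLESix_iff_bulkNondegenerate_or_conjecture :
    ParafermionFamiliesToSLESix ↔
      (ParafermionBulkNondegenerate ∨ Summit.CriticalPhenomena.CardyFormulaZ2.SLE6LimitZ2AllDiscretisations) := by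
  rw [parafermionFamiliesToSLESix_iff_not_bulkNondegenerate_imp]
  exact ⟨fun h => (em ParafermionBulkNondegenerate).imp_right h, fun h hn => h.resolve_left hn⟩

end Summit.CriticalPhenomena.CardyFormulaZ2.Theorems.ParafermionFamiliesToSLESix.StripAnchored

end
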